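import Mathlib
import HarnessLib
import Summits.Ventures.LatticeQCDFlow.Exactness.GaugeFTHMCSymmetricWord
import Summits.Ventures.LatticeQCDFlow.Exactness.U1NearFreeFlight
import Summits.Ventures.LatticeQCDFlow.Exactness.U1WordDoeblin

/-!
# Multi-step OMF2 HMC on `U(1)` lattice gauge fields is uniformly ergodic for short trajectories

HONEST FRAMING: exact (Metropolis-corrected) sampling algorithms for lattice gauge theory;
figures of merit are autocorrelation/cost numbers at stated couplings and volumes; no
continuum-physics claim.

Venture `LatticeQCDFlow` (cell pub-lqcd), topic `Exactness`, FANOUT row 14 (`eng-flowhmc`, engine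
`latflow.fthmc`, family B, `U(1)` rung, integrator `omf2` at any `n_md`; equally row 9's
`latflow.core.hmc.HMC(..., 'omf2')`).  NEW WORK of the cell over row 9's `SplittingWords.lean`
(`omf2Word = K(g₁) D K(g₂) D K(g₁)`, its flip reversibility and Liouville stage by stage), GEN-6's
`GaugeFTHMCSymmetricWord.lean` (`measurable_flip_omf2Word_pow`), and this row's
`U1NearFreeFlight.lean` (append-kick / append-drift / power lemma) and `U1WordDoeblin.lean` (the
integrator-independent Doeblin core); nothing is cited as a fact; no number.  Printed counterparts,
named only: Omelyan–Mryglod–Folk 2003 (the integrator); Mackenzie 1989 (resonances).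

* §1 **`omf2_nearFreeFlight`** — one OMF2 step `K(g₁) D_c K(g₂) D_c K(g₁)` on `U(1)^ι` (drifts
  `V_l ← e^{icp_l} V_l`, kicks `‖g₁‖, ‖g₂‖ ≤ b`, both `L`-Lipschitz) is a near-free-flight map with
  total drift `2c` and constants `α₀ = 3|c|b`, `α₁ = |c|L(3 + |c|L)`, `α₂ = c²L`, `β₀ = 3b`,
  `β₁ = L(3 + 4|c|L + c²L²)`, `β₂ = |c|L(3 + |c|L)` (five applications of the append lemmas);
* §2 `u1Omf2HMC_pow_invariant_gibbsLaw` — the `n`-step OMF2 kernel (refresh, `(OMF2)ⁿ`, flip,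
  Metropolis on `S + T_κ`, forget) leaves `π_S` invariant for every measurable `S`, `g₁`, `g₂`,
  every `c`, `n`, `κ > 0` (exactness);
* §3 **`u1Omf2HMC_pow_uniformlyErgodic`**, **`u1Omf2HMC_pow_invariant_unique`** — for `c > 0`,
  `κ > 0`, `n ≥ 1`, measurable `|S| ≤ s` and the SHORT-TRAJECTORY CONDITION `64 · L · c · n² ≤ 1`:
  `|μ₀Kᵗ(A) − π_S(A)| ≤ (1 − δ)ᵗ` from EVERY initial law and `π_S` is the unique invariant
  probability law.  (The constant `64` is NOT optimised: it is what the generic power lemma's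
  bootstrap gives; the leapfrog-specific file has `L|ε|n² ≤ 1`.)

NOT CLAIMED: `c ≤ 0`; longer trajectories; OMF4 (eleven stages — the same five-line recipe, not
written); `SU(2)`; any usable `δ`; floating point; any number.
-/

noncomputable section

namespace Summit.Ventures.LatticeQCDFlow.Exactness

open MeasureTheory ProbabilityTheory ProbabilityTheory.Kernel Set Metric
open Literature.MathematicalPhysics.QuantumFieldTheory (haarProbability)
open scoped ENNReal NNReal

variable {ι : Type*} [Fintype ι]

/-! ## §1 One OMF2 step is a near-free-flight map -/

section Step

variable (c : ℝ) {g₁ g₂ : (ι → Circle) → ι → ℝ} {b : ℝ} {L : ℝ≥0}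

omit [Fintype ι] in
/-- The OMF2 word applied: `K(g₁) (D (K(g₂) (D (K(g₁) z))))`. -/
theorem omf2Word_apply (d : (ι → ℝ) → Equiv.Perm (ι → Circle)) (g₁ g₂ : (ι → Circle) → ι → ℝ)
    (z : (ι → Circle) × (ι → ℝ)) :
    omf2Word g₁ d g₂ z = (⇑(kick g₁) ∘ ⇑(drift d) ∘ ⇑(kick g₂) ∘ ⇑(drift d) ∘ ⇑(kick g₁) ∘ id) z := by
  rfl

/-- **One OMF2 step `K(g₁) D_c K(g₂) D_c K(g₁)` on `U(1)^ι` is a near-free-flight map** with total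
drift `2c` and the six constants `3|c|b, |c|L(3 + |c|L), c²L; 3b, L(3 + 4|c|L + c²L²), |c|L(3 + |c|L)`
(kicks bounded by `b`, `L`-Lipschitz). -/
theorem omf2_nearFreeFlight (hb₁ : ∀ v, ‖g₁ v‖ ≤ b) (hb₂ : ∀ v, ‖g₂ v‖ ≤ b)
    (hL₁ : LipschitzWith L g₁) (hL₂ : LipschitzWith L g₂) :
    ∃ A B : (ι → Circle) → (ι → ℝ) → ι → ℝ,
      (∀ z : (ι → Circle) × (ι → ℝ), omf2Word g₁ (mulDrift (u1ExpDrift c)) g₂ z =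
        (u1ExpDrift 1 ((2 * c) • z.2 + A z.1 z.2) * z.1, z.2 + B z.1 z.2)) ∧
      (∀ v q, ‖A v q‖ ≤ 3 * |c| * b) ∧ (∀ v q, ‖B v q‖ ≤ 3 * b) ∧
      (∀ v v' q q', ‖A v q - A v' q'‖ ≤
        |c| * L * (3 + |c| * L) * dist v v' + |c| ^ 2 * L * ‖q - q'‖) ∧
      (∀ v v' q q', ‖B v q - B v' q'‖ ≤
        L * (3 + 4 * |c| * L + |c| ^ 2 * L ^ 2) * dist v v' + |c| * L * (3 + |c| * L) * ‖q - q'‖) := by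
  -- stage 0: the identity
  set Z : (ι → Circle) → (ι → ℝ) → ι → ℝ := fun _ _ => 0 with hZ
  have hΦ₀ : ∀ z : (ι → Circle) × (ι → ℝ),
      id z = (u1ExpDrift 1 ((0 : ℝ) • z.2 + Z z.1 z.2) * z.1, z.2 + Z z.1 z.2) := nearFreeFlight_id
  have hZ0 : ∀ v q, ‖Z v q‖ ≤ 0 := fun v q => by simp [hZ]
  have hZL : ∀ (v v' : ι → Circle) (q q' : ι → ℝ), ‖Z v q - Z v' q'‖ ≤ 0 * dist v v' + 0 * ‖q - q'‖ :=
    fun v v' q q' => by simp [hZ]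
  -- stage 1: kick g₁
  set B₁ : (ι → Circle) → (ι → ℝ) → ι → ℝ :=
    fun v q => Z v q + g₁ (u1ExpDrift 1 ((0 : ℝ) • q + Z v q) * v) with hB₁
  have hΦ₁ : ∀ z : (ι → Circle) × (ι → ℝ), (⇑(kick g₁) ∘ id) z =
      (u1ExpDrift 1 ((0 : ℝ) • z.2 + Z z.1 z.2) * z.1, z.2 + B₁ z.1 z.2) :=
    nearFreeFlight_kick hΦ₀ g₁
  have hb1 := nearFreeFlight_kick_bounds (τ := (0 : ℝ)) (A := Z) (B := Z) hZ0 hZL hZL hb₁ hL₁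
  -- stage 2: drift c
  set A₂ : (ι → Circle) → (ι → ℝ) → ι → ℝ := fun v q => Z v q + c • B₁ v q with hA₂
  have hΦ₂ : ∀ z : (ι → Circle) × (ι → ℝ), (⇑(drift (mulDrift (u1ExpDrift c))) ∘ (⇑(kick g₁) ∘ id)) z =
      (u1ExpDrift 1 (((0 : ℝ) + c) • z.2 + A₂ z.1 z.2) * z.1, z.2 + B₁ z.1 z.2) :=
    nearFreeFlight_drift hΦ₁ c
  have ha2 := nearFreeFlight_drift_bounds (A := Z) (B := B₁) hZ0 hb1.1 hZL hb1.2 c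
  -- stage 3: kick g₂
  set B₃ : (ι → Circle) → (ι → ℝ) → ι → ℝ :=
    fun v q => B₁ v q + g₂ (u1ExpDrift 1 (((0 : ℝ) + c) • q + A₂ v q) * v) with hB₃
  have hΦ₃ : ∀ z : (ι → Circle) × (ι → ℝ),
      (⇑(kick g₂) ∘ (⇑(drift (mulDrift (u1ExpDrift c))) ∘ (⇑(kick g₁) ∘ id))) z =
      (u1ExpDrift 1 (((0 : ℝ) + c) • z.2 + A₂ z.1 z.2) * z.1, z.2 + B₃ z.1 z.2) :=
    nearFreeFlight_kick hΦ₂ g₂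
  have hb3 := nearFreeFlight_kick_bounds (τ := (0 : ℝ) + c) (A := A₂) (B := B₁) hb1.1 ha2.2 hb1.2 hb₂ hL₂
  -- stage 4: drift c
  set A₄ : (ι → Circle) → (ι → ℝ) → ι → ℝ := fun v q => A₂ v q + c • B₃ v q with hA₄
  have hΦ₄ : ∀ z : (ι → Circle) × (ι → ℝ),
      (⇑(drift (mulDrift (u1ExpDrift c))) ∘ (⇑(kick g₂) ∘ (⇑(drift (mulDrift (u1ExpDrift c))) ∘
        (⇑(kick g₁) ∘ id)))) z =
      (u1ExpDrift 1 (((0 : ℝ) + c + c) • z.2 + A₄ z.1 z.2) * z.1, z.2 + B₃ z.1 z.2) :=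
    nearFreeFlight_drift hΦ₃ c
  have ha4 := nearFreeFlight_drift_bounds (A := A₂) (B := B₃) ha2.1 hb3.1 ha2.2 hb3.2 c
  -- stage 5: kick g₁
  set B₅ : (ι → Circle) → (ι → ℝ) → ι → ℝ :=
    fun v q => B₃ v q + g₁ (u1ExpDrift 1 (((0 : ℝ) + c + c) • q + A₄ v q) * v) with hB₅
  have hΦ₅ : ∀ z : (ι → Circle) × (ι → ℝ),
      (⇑(kick g₁) ∘ (⇑(drift (mulDrift (u1ExpDrift c))) ∘ (⇑(kick g₂) ∘
        (⇑(drift (mulDrift (u1ExpDrift c))) ∘ (⇑(kick g₁) ∘ id))))) z =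
      (u1ExpDrift 1 (((0 : ℝ) + c + c) • z.2 + A₄ z.1 z.2) * z.1, z.2 + B₅ z.1 z.2) :=
    nearFreeFlight_kick hΦ₄ g₁
  have hb5 := nearFreeFlight_kick_bounds (τ := (0 : ℝ) + c + c) (A := A₄) (B := B₃) hb3.1 ha4.2 hb3.2
    hb₁ hL₁
  have e1 : |(0 : ℝ)| = 0 := abs_zero
  have e2 : |(0 : ℝ) + c| = |c| := by rw [zero_add]
  have e3 : |(0 : ℝ) + c + c| = 2 * |c| := by rw [zero_add, ← two_mul, abs_mul, abs_two]
  refine ⟨A₄, B₅, fun z => ?_, fun v q => ?_, fun v q => ?_, fun v v' q q' => ?_, fun v v' q q' => ?_⟩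
  · rw [omf2Word_apply, hΦ₅ z, show (0 : ℝ) + c + c = 2 * c by ring]
  · refine (ha4.1 v q).trans (le_of_eq ?_)
    ring
  · refine (hb5.1 v q).trans (le_of_eq ?_)
    ring
  · refine (ha4.2 v v' q q').trans (le_of_eq ?_)
    rw [e1, e2]
    ring
  · refine (hb5.2 v v' q q').trans (le_of_eq ?_)
    rw [e1, e2, e3]
    ring

end Step

/-! ## §2 The `n`-step OMF2 kernel is exact -/

section Kernel

variable {c κ : ℝ} {g₁ g₂ : (ι → Circle) → ι → ℝ}

omit [Fintype ι] in
/-- `flip ∘ (OMF2)ⁿ` is an involution. -/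
theorem involutive_u1Omf2Proposal_pow (c : ℝ) (g₁ g₂ : (ι → Circle) → ι → ℝ) (n : ℕ) :
    Function.Involutive (⇑((flip : Equiv.Perm ((ι → Circle) × (ι → ℝ))) *
      omf2Word g₁ (mulDrift (u1ExpDrift c)) g₂ ^ n)) :=
  (palindromicWord_pow_isFlipReversible flip_mul_flip (kick_isFlipReversible g₂)
    (omf2_stages_isFlipReversible (mulDrift_reversal (u1ExpDrift_neg c))) n).involutive

/-- `flip ∘ (OMF2)ⁿ` preserves `Haar^{⊗ι} ⊗ Lebesgue`. -/
theorem measurePreserving_u1Omf2Proposal_pow (c : ℝ) (hg₁ : Measurable g₁) (hg₂ : Measurable g₂)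
    (n : ℕ) :
    MeasurePreserving (⇑((flip : Equiv.Perm ((ι → Circle) × (ι → ℝ))) *
        omf2Word g₁ (mulDrift (u1ExpDrift c)) g₂ ^ n))
      ((Measure.pi fun _ : ι => haarProbability Circle).prod volume)
      ((Measure.pi fun _ : ι => haarProbability Circle).prod volume) := by
  haveI := isNegInvariant_volume_pi (Λ := ι)
  rw [Equiv.Perm.coe_mul]
  exact measurePreserving_flip.comp (measurePreserving_perm_pow
    (measurePreserving_palindromicWord (measurePreserving_kick hg₂)
      (omf2_stages_measurePreserving (measurable_mulDrift (measurable_u1ExpDrift c))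
        (measurePreserving_mulDrift (u1ExpDrift c)) hg₁)) n)

/-- **Exactness of `n`-step OMF2 HMC on `U(1)^ι`**: `π_S` is invariant, every measurable `S`,
`g₁`, `g₂`, every `c`, `n`, `κ > 0`. -/
theorem u1Omf2HMC_pow_invariant_gibbsLaw (hκ : 0 < κ) (hg₁ : Measurable g₁) (hg₂ : Measurable g₂)
    (n : ℕ) {S : (ι → Circle) → ℝ} (hS : Measurable S) :
    Invariant (refreshUpdate (involMH _
        (measurable_flip_omf2Word_pow (measurable_u1ExpDrift c) hg₁ hg₂ n)
        fun z : (ι → Circle) × (ι → ℝ) => S z.1 + u1Kinetic κ z.2) (u1MomentumLaw κ)) (u1GibbsLaw S) :=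
  u1Word_invariant_gibbsLaw _ hκ (involutive_u1Omf2Proposal_pow c g₁ g₂ n)
    (measurePreserving_u1Omf2Proposal_pow c hg₁ hg₂ n) hS

end Kernel

/-! ## §3 Doeblin and uniform ergodicity under the short-trajectory condition -/

section Ergodic

variable {c κ : ℝ} {g₁ g₂ : (ι → Circle) → ι → ℝ} {b : ℝ} {L : ℝ≥0} {S : (ι → Circle) → ℝ} {s : ℝ}

/-- The short-trajectory condition `64 L c n² ≤ 1` implies the two hypotheses of the power lemma
for the OMF2 data. -/
theorem omf2_shortTrajectory (hc : 0 < c) {n : ℕ} (hn0 : 0 < n)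
    (hn : 64 * (L : ℝ) * c * (n : ℝ) ^ 2 ≤ 1) :
    3 * (L * (3 + 4 * |c| * L + |c| ^ 2 * L ^ 2) * |2 * c| ^ 2 * (n : ℝ) ^ 2 +
        (|c| * L * (3 + |c| * L) + |c| * L * (3 + |c| * L)) * |2 * c| * n + 2 * (|c| ^ 2 * L)) ≤
      |2 * c| ∧
    L * (3 + 4 * |c| * L + |c| ^ 2 * L ^ 2) * |2 * c| * (n : ℝ) ^ 2 +
        2 * (|c| * L * (3 + |c| * L)) * n ≤ 1 := by
  have hL0 : (0 : ℝ) ≤ L := NNReal.coe_nonneg L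
  have hn1 : (1 : ℝ) ≤ n := by exact_mod_cast hn0
  have hu0 : 0 ≤ c * L := mul_nonneg hc.le hL0
  have hX : c * L * (n : ℝ) ^ 2 ≤ 1 / 64 := by nlinarith
  have hnn : (n : ℝ) ≤ (n : ℝ) ^ 2 := by nlinarith
  have hY : c * L * n ≤ 1 / 64 := (mul_le_mul_of_nonneg_left hnn hu0).trans hX
  have hu : c * L ≤ 1 / 64 := (le_mul_of_one_le_right hu0 hn1).trans hY
  have p1 : c * L * (c * L * (n : ℝ) ^ 2) ≤ 1 / 64 * (c * L * (n : ℝ) ^ 2) :=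
    mul_le_mul_of_nonneg_right hu (by positivity)
  have p2 : (c * L) ^ 2 * (c * L * (n : ℝ) ^ 2) ≤ (1 / 64) ^ 2 * (c * L * (n : ℝ) ^ 2) :=
    mul_le_mul_of_nonneg_right (pow_le_pow_left₀ hu0 hu 2) (by positivity)
  have p3 : c * L * (c * L * n) ≤ 1 / 64 * (c * L * n) :=
    mul_le_mul_of_nonneg_right hu (by positivity)
  rw [abs_of_pos hc, abs_of_pos (by positivity : (0 : ℝ) < 2 * c)]
  constructor
  · have key : 3 * (L * (3 + 4 * c * L + c ^ 2 * L ^ 2) * (2 * c) ^ 2 * (n : ℝ) ^ 2 +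
        (c * L * (3 + c * L) + c * L * (3 + c * L)) * (2 * c) * n + 2 * (c ^ 2 * L)) =
        c * (36 * (c * L * (n : ℝ) ^ 2) + 48 * (c * L * (c * L * (n : ℝ) ^ 2)) +
          12 * ((c * L) ^ 2 * (c * L * (n : ℝ) ^ 2)) + 36 * (c * L * n) + 12 * (c * L * (c * L * n)) +
          6 * (c * L)) := by ring
    rw [key]
    have hP : 36 * (c * L * (n : ℝ) ^ 2) + 48 * (c * L * (c * L * (n : ℝ) ^ 2)) +
          12 * ((c * L) ^ 2 * (c * L * (n : ℝ) ^ 2)) + 36 * (c * L * n) + 12 * (c * L * (c * L * n)) +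
          6 * (c * L) ≤ 2 := by linarith
    calc _ ≤ c * 2 := mul_le_mul_of_nonneg_left hP hc.le
      _ = 2 * c := mul_comm _ _
  · have key : (L : ℝ) * (3 + 4 * c * L + c ^ 2 * L ^ 2) * (2 * c) * (n : ℝ) ^ 2 +
        2 * (c * L * (3 + c * L)) * n =
        6 * (c * L * (n : ℝ) ^ 2) + 8 * (c * L * (c * L * (n : ℝ) ^ 2)) +
          2 * ((c * L) ^ 2 * (c * L * (n : ℝ) ^ 2)) + 6 * (c * L * n) + 2 * (c * L * (c * L * n)) := by
      ring
    rw [key]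
    linarith

/-- **The position/momentum readings of `n` OMF2 steps** under `64 L c n² ≤ 1` (`c > 0`): from every
`u` the proposed configuration of `flip ∘ (OMF2)ⁿ` is `e₁((2cn) • p + G_u p) · u` with
`‖G_u‖ ≤ 3ncb + 3cbn²`, `G_u` `(2cn/3)`-Lipschitz, and the proposed momentum has norm `≤ ‖p‖ + 3nb`. -/
theorem u1Omf2_pow_readings (hc : 0 < c) (hb₁ : ∀ v, ‖g₁ v‖ ≤ b) (hb₂ : ∀ v, ‖g₂ v‖ ≤ b)
    (hL₁ : LipschitzWith L g₁) (hL₂ : LipschitzWith L g₂) {n : ℕ} (hn0 : 0 < n)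
    (hn : 64 * (L : ℝ) * c * (n : ℝ) ^ 2 ≤ 1) :
    (∀ u, ∃ G : (ι → ℝ) → ι → ℝ, (∀ p, ‖G p‖ ≤ n * (3 * |c| * b) + |2 * c| * (3 * b) * (n : ℝ) ^ 2 / 2) ∧
      LipschitzWith (Real.toNNReal (n * |2 * c| / 3)) G ∧
      ∀ p, (((flip : Equiv.Perm ((ι → Circle) × (ι → ℝ))) *
          omf2Word g₁ (mulDrift (u1ExpDrift c)) g₂ ^ n) (u, p)).1 =
        u1ExpDrift 1 (((n : ℝ) * (2 * c)) • p + G p) * u) ∧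
    (∀ u p, ‖(((flip : Equiv.Perm ((ι → Circle) × (ι → ℝ))) *
        omf2Word g₁ (mulDrift (u1ExpDrift c)) g₂ ^ n) (u, p)).2‖ ≤ ‖p‖ + n * (3 * b)) := by
  obtain ⟨A, B, hΦ, hA0, hB0, hA, hB⟩ := omf2_nearFreeFlight (ι := ι) c hb₁ hb₂ hL₁ hL₂
  obtain ⟨h1, h2⟩ := omf2_shortTrajectory (L := L) hc hn0 hn
  have hL0 : (0 : ℝ) ≤ L := NNReal.coe_nonneg L
  have hα₁ : 0 ≤ |c| * L * (3 + |c| * L) := by positivity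
  have hα₂ : 0 ≤ |c| ^ 2 * (L : ℝ) := by positivity
  have hβ₁ : 0 ≤ (L : ℝ) * (3 + 4 * |c| * L + |c| ^ 2 * L ^ 2) := by positivity
  refine ⟨fun u => ?_, fun u p => ?_⟩
  · obtain ⟨G, hGb, hGL, hfst⟩ :=
      nearFreeFlight_iterate_fst hΦ hA0 hB0 hA hB hα₁ hα₂ hβ₁ hα₁ h1 h2 u
    refine ⟨G, hGb, hGL, fun p => ?_⟩
    rw [Equiv.Perm.mul_apply, flip_apply, Equiv.Perm.coe_pow, hfst p]
  · rw [Equiv.Perm.mul_apply, flip_apply, Equiv.Perm.coe_pow]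
    dsimp only
    rw [norm_neg]
    have h := nearFreeFlight_iterate_snd hΦ hA0 hB0 hA hB hα₁ hα₂ hβ₁ hα₁ h1 h2 u p
    calc ‖((⇑(omf2Word g₁ (mulDrift (u1ExpDrift c)) g₂))^[n] (u, p)).2‖
        = ‖(((⇑(omf2Word g₁ (mulDrift (u1ExpDrift c)) g₂))^[n] (u, p)).2 - p) + p‖ := by
          rw [sub_add_cancel]
      _ ≤ ‖((⇑(omf2Word g₁ (mulDrift (u1ExpDrift c)) g₂))^[n] (u, p)).2 - p‖ + ‖p‖ := norm_add_le _ _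
      _ ≤ n * (3 * b) + ‖p‖ := add_le_add h le_rfl
      _ = ‖p‖ + n * (3 * b) := add_comm _ _

/-- **`n`-STEP OMF2 HMC ON `U(1)^ι` IS UNIFORMLY ERGODIC FOR SHORT TRAJECTORIES.**  Half-drift
`c > 0` (the engine's `ε/2`), `κ > 0`, `n ≥ 1`, kicks `g₁, g₂` bounded by `b` and `L`-Lipschitz,
measurable action `|S| ≤ s`, and `64 · L · c · n² ≤ 1`: there is `δ ∈ (0, 1]` with
`|μ₀Kᵗ(A) − π_S(A)| ≤ (1 − δ)ᵗ` for EVERY initial law `μ₀`, every `t`, every set `A`. -/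
theorem u1Omf2HMC_pow_uniformlyErgodic (hc : 0 < c) (hκ : 0 < κ) (hg₁ : Measurable g₁)
    (hg₂ : Measurable g₂) (hb₁ : ∀ v, ‖g₁ v‖ ≤ b) (hb₂ : ∀ v, ‖g₂ v‖ ≤ b)
    (hL₁ : LipschitzWith L g₁) (hL₂ : LipschitzWith L g₂) {n : ℕ} (hn0 : 0 < n)
    (hn : 64 * (L : ℝ) * c * (n : ℝ) ^ 2 ≤ 1) (hS : Measurable S) (hs : ∀ u, |S u| ≤ s) :
    ∃ δ : ℝ, 0 < δ ∧ δ ≤ 1 ∧ ∀ (μ₀ : Measure (ι → Circle)) [IsProbabilityMeasure μ₀] (t : ℕ)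
      (A : Set (ι → Circle)),
      |((fun m : Measure (ι → Circle) => m.bind
          (refreshUpdate (involMH _
            (measurable_flip_omf2Word_pow (measurable_u1ExpDrift c) hg₁ hg₂ n)
            fun z : (ι → Circle) × (ι → ℝ) => S z.1 + u1Kinetic κ z.2) (u1MomentumLaw κ)))^[t] μ₀).real A
          - (u1GibbsLaw S).real A| ≤ (1 - δ) ^ t := by
  have hb0 : 0 ≤ b := (norm_nonneg _).trans (hb₁ fun _ => 1)
  obtain ⟨hfst, hsnd⟩ := u1Omf2_pow_readings (ι := ι) hc hb₁ hb₂ hL₁ hL₂ hn0 hn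
  have hnR : (0 : ℝ) < n := by exact_mod_cast hn0
  have ha : (0 : ℝ) < n * (2 * c) := by positivity
  have hlam : ((Real.toNNReal (n * |2 * c| / 3) : ℝ≥0) : ℝ) < n * (2 * c) := by
    rw [Real.coe_toNNReal _ (by positivity), abs_of_pos (by positivity : (0 : ℝ) < 2 * c)]
    nlinarith
  exact u1Word_uniformlyErgodic _ hκ ha hlam (by positivity) hfst hsnd hS hs
    (u1Omf2HMC_pow_invariant_gibbsLaw hκ hg₁ hg₂ n hS)

/-- **`π_S` is the unique invariant probability law of `n`-step OMF2 HMC on `U(1)^ι`** under the same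
short-trajectory condition. -/
theorem u1Omf2HMC_pow_invariant_unique (hc : 0 < c) (hκ : 0 < κ) (hg₁ : Measurable g₁)
    (hg₂ : Measurable g₂) (hb₁ : ∀ v, ‖g₁ v‖ ≤ b) (hb₂ : ∀ v, ‖g₂ v‖ ≤ b)
    (hL₁ : LipschitzWith L g₁) (hL₂ : LipschitzWith L g₂) {n : ℕ} (hn0 : 0 < n)
    (hn : 64 * (L : ℝ) * c * (n : ℝ) ^ 2 ≤ 1) (hS : Measurable S) (hs : ∀ u, |S u| ≤ s)
    {π' : Measure (ι → Circle)} [IsProbabilityMeasure π']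
    (hπ' : Invariant (refreshUpdate (involMH _
        (measurable_flip_omf2Word_pow (measurable_u1ExpDrift c) hg₁ hg₂ n)
        fun z : (ι → Circle) × (ι → ℝ) => S z.1 + u1Kinetic κ z.2) (u1MomentumLaw κ)) π') :
    π' = u1GibbsLaw S := by
  have hb0 : 0 ≤ b := (norm_nonneg _).trans (hb₁ fun _ => 1)
  obtain ⟨hfst, hsnd⟩ := u1Omf2_pow_readings (ι := ι) hc hb₁ hb₂ hL₁ hL₂ hn0 hn
  have hnR : (0 : ℝ) < n := by exact_mod_cast hn0
  have ha : (0 : ℝ) < n * (2 * c) := by positivity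
  have hlam : ((Real.toNNReal (n * |2 * c| / 3) : ℝ≥0) : ℝ) < n * (2 * c) := by
    rw [Real.coe_toNNReal _ (by positivity), abs_of_pos (by positivity : (0 : ℝ) < 2 * c)]
    nlinarith
  exact u1Word_invariant_unique _ hκ ha hlam (by positivity) hfst hsnd hS hs
    (u1Omf2HMC_pow_invariant_gibbsLaw hκ hg₁ hg₂ n hS) hπ'

end Ergodic

end Summit.Ventures.LatticeQCDFlow.Exactness
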